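import Mathlib.LinearAlgebra.Matrix.Transvection
import Mathlib.LinearAlgebra.Matrix.Permutation
import Literature.LinearAlgebra.Matrix.DiagonalTorusGL
import HarnessLib

/-!
# Homomorphisms from `GL_n(K)` to an abelian group factor through the determinant

Topic `LinearAlgebra/Matrix`; namespace `Literature.LinearAlgebra.Matrix.GLHomDet`.  KERNEL only (theorems, no
definition, no named fact, no `sorry`): for a field `K` with an element `a ∉ {0, 1}` (i.e. `K ≠ 𝔽₂`), a finite
index type `n` and ANY group homomorphism `θ : GL n K →* A` into a commutative group,

* `apply_eq_one_of_val_eq_transvection` — `θ` kills every transvection (a transvection is a commutator `[d, t]`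
  with a diagonal `d`);
* `apply_diagGL_eq` — on the diagonal torus (`Literature.LinearAlgebra.Matrix.DiagonalTorus.diagGL`) `θ (diag u)`
  depends only on `∏ uᵢ` (conjugating by a transposition matrix permutes the diagonal, so all the coordinate characters
  coincide);
* **`apply_eq_apply_diagGL_det`** — `θ g = θ (diag(det g at i₀))`, i.e. `θ` factors through `det` along the section
  `x ↦ diag(1,…,x,…,1)` (Mathlib's transvection induction `Matrix.diagonal_transvection_induction_of_det_ne_zero`);
* **`apply_eq_one_of_det_eq_one`** — hence `θ g = 1` whenever `det g = 1`, and `apply_eq_of_det_eq`.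

This is the classical statement `SL_n(K) ≤ [GL_n(K), GL_n(K)]` for `K ≠ 𝔽₂` ([Artin1988, Chap. IV Thm. 4.6];
Mathlib has the `SL₂` case as `Matrix.SL2.commutator_eq_top`), in the form consumed by the tree's adelic assembly
of characters of unitary groups at SPLIT places (`U(J)(F_v) ≅ GL₃(E_w)`, `UnitaryGroup.localPiSplitEquiv`).

## References

* E. Artin, *Geometric Algebra*, Interscience (1957), Chap. IV Thm. 4.6 [Artin1988].
-/

set_option autoImplicit false

open Matrix

namespace Literature.LinearAlgebra.Matrix

namespace GLHomDet

variable {K : Type*} [Field K] {n : Type*} [Fintype n] [DecidableEq n] {A : Type*} [CommGroup A]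

/-! ## §1 Conjugation by permutation matrices; the diagonal torus -/

/-- Conjugating by a permutation matrix reindexes: `P_σ M P_σ⁻¹ = M ∘ (σ × σ)`. [folklore] -/
private theorem permMatrix_mul_mul_permMatrix_inv (σ : Equiv.Perm n) (M : Matrix n n K) :
    σ.permMatrix K * M * σ⁻¹.permMatrix K = M.submatrix σ σ := by
  rw [Equiv.Perm.permMatrix, Equiv.Perm.permMatrix, PEquiv.toMatrix_toPEquiv_mul,
    PEquiv.mul_toMatrix_toPEquiv]
  rfl

/-- A permutation matrix in `GL n K` conjugates a diagonal torus element to the permuted one: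
`∃ p, p · diag(u) · p⁻¹ = diag(u ∘ σ)`. [folklore] -/
private theorem exists_conj_diagGL_eq (σ : Equiv.Perm n) (u : n → Kˣ) :
    ∃ p : GL n K, p * DiagonalTorus.diagGL n u * p⁻¹ = DiagonalTorus.diagGL n (u ∘ σ) := by
  refine ⟨⟨σ.permMatrix K, σ⁻¹.permMatrix K,
    by rw [← Matrix.permMatrix_mul, inv_mul_cancel, Matrix.permMatrix_one],
    by rw [← Matrix.permMatrix_mul, mul_inv_cancel, Matrix.permMatrix_one]⟩, Units.ext ?_⟩
  rw [Units.val_mul, Units.val_mul, DiagonalTorus.val_diagGL, DiagonalTorus.val_diagGL]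
  show σ.permMatrix K * _ * σ⁻¹.permMatrix K = _
  rw [permMatrix_mul_mul_permMatrix_inv, submatrix_diagonal_equiv]
  rfl

/-- A homomorphism to a commutative group is invariant under conjugation. [folklore] -/
private theorem apply_conj (θ : GL n K →* A) (p g : GL n K) : θ (p * g * p⁻¹) = θ g := by
  rw [map_mul, map_mul, map_inv, mul_right_comm, mul_inv_cancel, one_mul]

/-- `θ (diag (u ∘ σ)) = θ (diag u)`. [folklore] -/
private theorem apply_diagGL_comp_perm (θ : GL n K →* A) (σ : Equiv.Perm n) (u : n → Kˣ) :
    θ (DiagonalTorus.diagGL n (u ∘ σ)) = θ (DiagonalTorus.diagGL n u) := by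
  obtain ⟨p, hp⟩ := exists_conj_diagGL_eq (K := K) σ u
  rw [← hp, apply_conj]

omit [Fintype n] in
/-- `mulSingle i x ∘ swap i j = mulSingle j x`. [folklore] -/
private theorem mulSingle_comp_swap (i j : n) (x : Kˣ) :
    (Pi.mulSingle i x : n → Kˣ) ∘ (Equiv.swap i j) = Pi.mulSingle j x := by
  funext k
  simp only [Function.comp_apply]
  by_cases hk : k = j
  · subst hk
    rw [Equiv.swap_apply_right, Pi.mulSingle_eq_same, Pi.mulSingle_eq_same]
  · by_cases hki : k = i
    · subst hki
      rw [Equiv.swap_apply_left, Pi.mulSingle_eq_of_ne hk, Pi.mulSingle_eq_of_ne (Ne.symm hk)]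
    · rw [Equiv.swap_apply_of_ne_of_ne hki hk, Pi.mulSingle_eq_of_ne hki, Pi.mulSingle_eq_of_ne hk]

/-- All the coordinate characters of `θ` on the diagonal torus coincide:
`θ (diag(…, x at i, …)) = θ (diag(…, x at j, …))`. [folklore] -/
private theorem apply_diagGL_mulSingle_eq (θ : GL n K →* A) (i j : n) (x : Kˣ) :
    θ (DiagonalTorus.diagGL n (Pi.mulSingle i x)) = θ (DiagonalTorus.diagGL n (Pi.mulSingle j x)) := by
  rw [← mulSingle_comp_swap i j x, apply_diagGL_comp_perm]

/-- **On the diagonal torus `θ` depends only on the determinant**: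
`θ (diag u) = θ (diag(∏ uᵢ at i₀))`. [folklore] -/
private theorem apply_diagGL_eq (θ : GL n K →* A) (i₀ : n) (u : n → Kˣ) :
    θ (DiagonalTorus.diagGL n u) = θ (DiagonalTorus.diagGL n (Pi.mulSingle i₀ (∏ i, u i))) := by
  set φ : (n → Kˣ) →* A := θ.comp (DiagonalTorus.diagGL n) with hφ
  have hu : (∏ i, Pi.mulSingle i (u i) : n → Kˣ) = u := Finset.univ_prod_mulSingle u
  have h1 : ∀ i, φ (Pi.mulSingle i (u i)) = φ (Pi.mulSingle i₀ (u i)) := fun i => by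
    simp only [hφ, MonoidHom.comp_apply]
    exact apply_diagGL_mulSingle_eq θ i i₀ (u i)
  have h2 : (∏ i, Pi.mulSingle i₀ (u i) : n → Kˣ) = Pi.mulSingle i₀ (∏ i, u i) := by
    have := (map_prod (MonoidHom.mulSingle (fun _ : n => Kˣ) i₀) u Finset.univ).symm
    simpa only [MonoidHom.mulSingle_apply] using this
  calc θ (DiagonalTorus.diagGL n u) = φ u := rfl
    _ = ∏ i, φ (Pi.mulSingle i (u i)) := by rw [← map_prod, hu]
    _ = ∏ i, φ (Pi.mulSingle i₀ (u i)) := Finset.prod_congr rfl fun i _ => h1 i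
    _ = φ (∏ i, Pi.mulSingle i₀ (u i)) := (map_prod φ _ _).symm
    _ = φ (Pi.mulSingle i₀ (∏ i, u i)) := by rw [h2]
    _ = θ (DiagonalTorus.diagGL n (Pi.mulSingle i₀ (∏ i, u i))) := rfl

/-- `det (diag u) = ∏ uᵢ`. [folklore] -/
private theorem det_diagGL (u : n → Kˣ) : Matrix.GeneralLinearGroup.det (DiagonalTorus.diagGL n u) = ∏ i, u i :=
  Units.ext (by rw [Matrix.GeneralLinearGroup.val_det_apply, DiagonalTorus.val_diagGL, det_diagonal,
    Units.coe_prod])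

/-- `det (diag(x at i₀)) = x`. [folklore] -/
private theorem det_diagGL_mulSingle (i₀ : n) (x : Kˣ) :
    Matrix.GeneralLinearGroup.det (DiagonalTorus.diagGL n (Pi.mulSingle i₀ x)) = x := by
  rw [det_diagGL, Finset.prod_eq_single i₀ (fun j _ hj => Pi.mulSingle_eq_of_ne hj _)
    (fun h => absurd (Finset.mem_univ i₀) h), Pi.mulSingle_eq_same]

/-! ## §2 Transvections are commutators -/

omit [Fintype n] in
/-- Entries of a transvection. [folklore] -/
private theorem transvection_apply' {R : Type*} [CommRing R] (i j : n) (c : R) (x y : n) :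
    transvection i j c x y = (if x = y then 1 else 0) + (if i = x ∧ j = y then c else 0) := by
  unfold transvection
  rw [Matrix.add_apply, Matrix.one_apply, Matrix.single_apply]

/-- Conjugating a transvection by diagonal matrices: `diag(d) · t_{ij}(c) · diag(e) = t_{ij}(dᵢ c eⱼ)` when
`d e = 1` entrywise. [folklore] -/
private theorem diagonal_mul_transvection_mul_diagonal {R : Type*} [CommRing R] {i j : n} (hij : i ≠ j) (c : R)
    (d e : n → R) (hde : ∀ k, d k * e k = 1) :
    diagonal d * transvection i j c * diagonal e = transvection i j (d i * c * e j) := by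
  ext x y
  rw [mul_diagonal, diagonal_mul, transvection_apply', transvection_apply']
  by_cases hxy : x = y
  · subst hxy
    have hne : ¬(i = x ∧ j = x) := fun h => hij (h.1.trans h.2.symm)
    simp only [if_true, if_neg hne, add_zero, mul_one, hde]
  · rw [if_neg hxy, zero_add, zero_add]
    by_cases h : i = x ∧ j = y
    · obtain ⟨rfl, rfl⟩ := h
      rw [if_pos ⟨rfl, rfl⟩, if_pos ⟨rfl, rfl⟩]
    · rw [if_neg h, if_neg h, mul_zero, zero_mul]

/-- `det (t_{ij}(c)) ≠ 0`. [folklore] -/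
private theorem det_transvection_ne_zero {i j : n} (hij : i ≠ j) (c : K) : (transvection i j c).det ≠ 0 := by
  rw [det_transvection_of_ne i j hij]; exact one_ne_zero

/-- `t(c) t(d) = t(c + d)` in `GL n K`. [folklore] -/
private theorem transvectionGL_mul {i j : n} (hij : i ≠ j) (c d : K) :
    Matrix.GeneralLinearGroup.mkOfDetNeZero _ (det_transvection_ne_zero hij c) *
        Matrix.GeneralLinearGroup.mkOfDetNeZero _ (det_transvection_ne_zero hij d) =
      Matrix.GeneralLinearGroup.mkOfDetNeZero _ (det_transvection_ne_zero hij (c + d)) :=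
  Units.ext (by
    rw [Units.val_mul]
    show transvection i j c * transvection i j d = transvection i j (c + d)
    exact transvection_mul_transvection_same i j hij c d)

/-- `t(0) = 1` in `GL n K`. [folklore] -/
private theorem transvectionGL_zero {i j : n} (hij : i ≠ j) :
    Matrix.GeneralLinearGroup.mkOfDetNeZero _ (det_transvection_ne_zero (K := K) hij 0) = 1 :=
  Units.ext (by
    show transvection i j (0 : K) = 1
    exact transvection_zero i j)

/-- Conjugating a transvection by the diagonal element `diag(a at i)` rescales it: `d t(c) d⁻¹ = t(a c)`. [folklore] -/
private theorem diagGL_mul_transvectionGL_mul_inv {i j : n} (hij : i ≠ j) (a : Kˣ) (c : K) :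
    DiagonalTorus.diagGL n (Pi.mulSingle i a) * Matrix.GeneralLinearGroup.mkOfDetNeZero _ (det_transvection_ne_zero hij c) *
        (DiagonalTorus.diagGL n (Pi.mulSingle i a))⁻¹ =
      Matrix.GeneralLinearGroup.mkOfDetNeZero _ (det_transvection_ne_zero hij ((a : K) * c)) := by
  refine Units.ext ?_
  rw [Units.val_mul, Units.val_mul, DiagonalTorus.val_diagGL, DiagonalTorus.val_inv_diagGL]
  show diagonal _ * transvection i j c * diagonal _ = transvection i j _
  rw [diagonal_mul_transvection_mul_diagonal hij c _ _ (fun k => by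
      rw [← Units.val_mul, mul_inv_cancel, Units.val_one])]
  congr 1
  rw [Pi.mulSingle_eq_same, Pi.mulSingle_eq_of_ne (Ne.symm hij), inv_one, Units.val_one, mul_one]

/-- **`θ` kills every transvection** (`K ≠ 𝔽₂`; `t((a-1)c) = [diag(a at i), t(c)]`): `θ g = 1` whenever the
matrix of `g` is a transvection. [cite: Artin1988, Chap. IV Thm. 4.6] -/
theorem apply_eq_one_of_val_eq_transvection (hK : ∃ a : K, a ≠ 0 ∧ a ≠ 1) (θ : GL n K →* A) {i j : n}
    (hij : i ≠ j) (c : K) {g : GL n K} (hg : (g : Matrix n n K) = transvection i j c) : θ g = 1 := by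
  obtain ⟨a, ha0, ha1⟩ := hK
  -- `T x` := the transvection `t_{ij}(x)` in `GL n K`
  set T : K → GL n K := fun x => Matrix.GeneralLinearGroup.mkOfDetNeZero _ (det_transvection_ne_zero hij x) with hT
  have hgT : g = T c := Units.ext (by rw [hg]; rfl)
  -- `θ (T (a x)) = θ (T x)` for every `x`
  have key : ∀ x : K, θ (T (a * x)) = θ (T x) := by
    intro x
    have hTx : T (a * x) = DiagonalTorus.diagGL n (Pi.mulSingle i (Units.mk0 a ha0)) * T x *
        (DiagonalTorus.diagGL n (Pi.mulSingle i (Units.mk0 a ha0)))⁻¹ :=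
      (diagGL_mul_transvectionGL_mul_inv hij (Units.mk0 a ha0) x).symm
    rw [hTx, apply_conj]
  have hsub : a - 1 ≠ 0 := sub_ne_zero.2 ha1
  have hc : c = a * (c / (a - 1)) + (-(c / (a - 1))) := by field_simp; ring
  have hmul : ∀ x y : K, T x * T y = T (x + y) := fun x y => transvectionGL_mul hij x y
  have hzero : T 0 = 1 := transvectionGL_zero hij
  rw [hgT, hc, ← hmul, map_mul, key, ← map_mul, hmul, add_neg_cancel, hzero, map_one]

/-! ## §3 The factorisation through `det` -/

/-- **Every homomorphism `GL_n(K) → A` (`A` abelian, `K ≠ 𝔽₂`) factors through `det`** along the section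
`x ↦ diag(1, …, x, …, 1)` (`x` at `i₀`): `θ g = θ (diag(det g at i₀))`. [cite: Artin1988, Chap. IV Thm. 4.6] -/
theorem apply_eq_apply_diagGL_det (hK : ∃ a : K, a ≠ 0 ∧ a ≠ 1) (θ : GL n K →* A) (i₀ : n) (g : GL n K) :
    θ g = θ (DiagonalTorus.diagGL n (Pi.mulSingle i₀ (Matrix.GeneralLinearGroup.det g))) := by
  suffices H : ∀ M : Matrix n n K, M.det ≠ 0 → ∀ g : GL n K, (g : Matrix n n K) = M →
      θ g = θ (DiagonalTorus.diagGL n (Pi.mulSingle i₀ (Matrix.GeneralLinearGroup.det g))) from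
    H _ (Matrix.GeneralLinearGroup.det_ne_zero g) g rfl
  intro M hM
  refine diagonal_transvection_induction_of_det_ne_zero
    (fun M => ∀ g : GL n K, (g : Matrix n n K) = M →
      θ g = θ (DiagonalTorus.diagGL n (Pi.mulSingle i₀ (Matrix.GeneralLinearGroup.det g)))) M hM ?_ ?_ ?_
  · -- invertible diagonal matrices
    intro D hD g hg
    have hDi : ∀ i, D i ≠ 0 := by
      intro i hi
      apply hD
      rw [det_diagonal]
      exact Finset.prod_eq_zero (Finset.mem_univ i) hi
    have hgu : g = DiagonalTorus.diagGL n (fun i => Units.mk0 (D i) (hDi i)) :=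
      Units.ext (by rw [hg, DiagonalTorus.val_diagGL]; rfl)
    rw [hgu, det_diagGL, apply_diagGL_eq θ i₀]
  · -- transvections
    intro t g hg
    have hdet : Matrix.GeneralLinearGroup.det g = 1 :=
      Units.ext (by rw [Matrix.GeneralLinearGroup.val_det_apply, hg, TransvectionStruct.det, Units.val_one])
    rw [hdet, Pi.mulSingle_one, map_one, map_one]
    exact apply_eq_one_of_val_eq_transvection hK θ t.hij t.c hg
  · -- products
    intro P Q hP hQ PP PQ g hg
    have hgPQ : g = Matrix.GeneralLinearGroup.mkOfDetNeZero P hP * Matrix.GeneralLinearGroup.mkOfDetNeZero Q hQ :=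
      Units.ext (by simpa [Matrix.GeneralLinearGroup.mkOfDetNeZero] using hg)
    have eP := PP (Matrix.GeneralLinearGroup.mkOfDetNeZero P hP) (by simp [Matrix.GeneralLinearGroup.mkOfDetNeZero])
    have eQ := PQ (Matrix.GeneralLinearGroup.mkOfDetNeZero Q hQ) (by simp [Matrix.GeneralLinearGroup.mkOfDetNeZero])
    rw [hgPQ, map_mul, map_mul, Pi.mulSingle_mul, map_mul, map_mul, eP, eQ]

/-- **`θ g = 1` whenever `det g = 1`** (`SL_n(K) ≤ ker θ`, `K ≠ 𝔽₂`). [cite: Artin1988, Chap. IV Thm. 4.6] -/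
theorem apply_eq_one_of_det_eq_one (hK : ∃ a : K, a ≠ 0 ∧ a ≠ 1) (θ : GL n K →* A) {g : GL n K}
    (hg : Matrix.GeneralLinearGroup.det g = 1) : θ g = 1 := by
  rcases isEmpty_or_nonempty n with hn | ⟨⟨i₀⟩⟩
  · have : g = 1 := Units.ext (Matrix.ext fun i _ => (IsEmpty.false i).elim)
    rw [this, map_one]
  · rw [apply_eq_apply_diagGL_det hK θ i₀, hg, Pi.mulSingle_one, map_one, map_one]

/-- The `det`-level form: `θ g = 1` whenever the matrix `g` has determinant `1`. [cite: Artin1988, Chap. IV Thm. 4.6] -/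
theorem apply_eq_one_of_val_det_eq_one (hK : ∃ a : K, a ≠ 0 ∧ a ≠ 1) (θ : GL n K →* A) {g : GL n K}
    (hg : (g : Matrix n n K).det = 1) : θ g = 1 :=
  apply_eq_one_of_det_eq_one hK θ (Units.ext (by rw [Matrix.GeneralLinearGroup.val_det_apply, hg, Units.val_one]))

/-- **Two elements with the same determinant have the same image.** [cite: Artin1988, Chap. IV Thm. 4.6] -/
theorem apply_eq_of_det_eq (hK : ∃ a : K, a ≠ 0 ∧ a ≠ 1) (θ : GL n K →* A) {g h : GL n K}
    (hgh : Matrix.GeneralLinearGroup.det g = Matrix.GeneralLinearGroup.det h) : θ g = θ h := by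
  have h1 : Matrix.GeneralLinearGroup.det (g * h⁻¹) = 1 := by rw [map_mul, map_inv, hgh, mul_inv_cancel]
  have h2 := apply_eq_one_of_det_eq_one hK θ h1
  rwa [map_mul, map_inv, mul_inv_eq_one] at h2

/-- The same with matrix determinants. [cite: Artin1988, Chap. IV Thm. 4.6] -/
theorem apply_eq_of_val_det_eq (hK : ∃ a : K, a ≠ 0 ∧ a ≠ 1) (θ : GL n K →* A) {g h : GL n K}
    (hgh : (g : Matrix n n K).det = (h : Matrix n n K).det) : θ g = θ h :=
  apply_eq_of_det_eq hK θ (Units.ext (by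
    rw [Matrix.GeneralLinearGroup.val_det_apply, Matrix.GeneralLinearGroup.val_det_apply, hgh]))

omit [Fintype n] [DecidableEq n] in
/-- In a field with `(2 : K) ≠ 0` the hypothesis `K ≠ 𝔽₂` holds with `a = 2`; in particular in characteristic
zero. [folklore] -/
private theorem exists_ne_zero_ne_one_of_two_ne_zero (h2 : (2 : K) ≠ 0) : ∃ a : K, a ≠ 0 ∧ a ≠ 1 :=
  ⟨2, h2, fun h => one_ne_zero (α := K) (by linear_combination h)⟩

/-- `θ g = 1` whenever `det g = 1`, for a field with `2 ≠ 0` (e.g. characteristic zero). [cite: Artin1988, Chap. IV Thm. 4.6] -/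
theorem apply_eq_one_of_val_det_eq_one_of_two_ne_zero (h2 : (2 : K) ≠ 0) (θ : GL n K →* A) {g : GL n K}
    (hg : (g : Matrix n n K).det = 1) : θ g = 1 :=
  apply_eq_one_of_val_det_eq_one (exists_ne_zero_ne_one_of_two_ne_zero h2) θ hg

/-- `θ g = θ h` whenever `det g = det h`, for a field with `2 ≠ 0` (e.g. characteristic zero).
[cite: Artin1988, Chap. IV Thm. 4.6] -/
theorem apply_eq_of_val_det_eq_of_two_ne_zero (h2 : (2 : K) ≠ 0) (θ : GL n K →* A) {g h : GL n K}
    (hgh : (g : Matrix n n K).det = (h : Matrix n n K).det) : θ g = θ h :=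
  apply_eq_of_val_det_eq (exists_ne_zero_ne_one_of_two_ne_zero h2) θ hgh

/-- `θ g = θ (diag(det g at i₀))`, for a field with `2 ≠ 0`. [cite: Artin1988, Chap. IV Thm. 4.6] -/
theorem apply_eq_apply_diagGL_det_of_two_ne_zero (h2 : (2 : K) ≠ 0) (θ : GL n K →* A) (i₀ : n) (g : GL n K) :
    θ g = θ (DiagonalTorus.diagGL n (Pi.mulSingle i₀ (Matrix.GeneralLinearGroup.det g))) :=
  apply_eq_apply_diagGL_det (exists_ne_zero_ne_one_of_two_ne_zero h2) θ i₀ g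

end GLHomDet

end Literature.LinearAlgebra.Matrix
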